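import Literature.RepresentationTheory.HeisenbergGroup.SchrodingerConjugateTorusSphericalCoeff
import Literature.RepresentationTheory.HeisenbergGroup.LeraySectionStabiliserAgreement
import HarnessLib

/-!
# Matrix coefficients of a Darboux-conjugate scalar torus in the Schrödinger model: the DECAY BOUND
# `|⟨M Φ, Φ'⟩| ≤ C(Φ, Φ') · min(‖t‖^{ι/2}, ‖t‖^{-ι/2})` for GENERAL Schwartz–Bruhat `Φ, Φ'`

Topic `RepresentationTheory/HeisenbergGroup`; namespace `Literature.RepresentationTheory.HeisenbergGroup`.  KERNEL only (theorems;
no definition, no named fact, no `sorry`).  Companion of `SchrodingerConjugateTorusSphericalCoeff.lean` (which computes the coefficients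
EXACTLY on the spherical vector `1_{𝒪^ι}` for a uniformiser): here the test functions are ARBITRARY and the scalar is ANY `t ≠ 0`,
and only an upper bound is proved — the local input, at a SPLIT place, of the absolute convergence of the orbital sums in Rallis' inner
product formula / the Siegel–Weil formula for the rank-one unitary dual pair ([Li1992, Thm 2.1 (27) p. 184, §5]; [Weil1965, n° 51]).

Setting: a non-archimedean local field `F`, the Schrödinger model `ρ_T` of the Heisenberg group of `W = F^ι × F^ι` with the Gram
duality `⟨x, T y⟩` (`det T` a unit) on `𝒮(F^ι)` (`schrodingerSB`), an element `γ ∈ Sp(W)` with an `L²(μ^ι)`-ISOMETRIC implementer `Γ`,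
a scalar `t ∈ F^×`, `a₀ = t · 1 ∈ GL_ι(F)`, and an `L²(μ^ι)`-ISOMETRIC implementer `M` of the conjugate torus element `γ⁻¹ m(a₀) γ`
(`m(a₀) = transportSp T (levi a₀)` the Siegel Levi element).

* `norm_integral_implementer_conjTorus_mul_conj_le` — **`‖∫ (M Φ) conj Φ' dμ^ι‖ ≤ max(A·∫|ΓΦ'|, ∫|ΓΦ|·A') · min(r, r⁻¹)`**,
  `r = √(‖t‖^{#ι})`, for any sup bounds `A ≥ |ΓΦ|`, `A' ≥ |ΓΦ'|`.
  Proof ([MoeglinVignerasWaldspurger1987, Chap. 2 II.1 (A), II.6]; [Weil1964, Chap. I n° 13]): implementers are unique up to a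
  scalar (★ `implementerUniqueUpToScalar_schrodingerSB_gram`), and `Γ⁻¹ ∘ r(m(a₀)) ∘ Γ` with the NORMALISED Levi operator
  `r(m(a₀))Ψ = ‖t‖^{-ι/2} Ψ(t⁻¹ ·)` (★ `leviOpPi`, ★ `implements_transportSp_levi_leviOpPi`, isometric by ★ `l2NormSq_leviOpPi`)
  implements the same element, so `M = c · Γ⁻¹ r(m(a₀)) Γ` with `|c| = 1` (both isometric, `𝒮 ≠ 0`); `Γ` preserves the pairing
  (★ `SchwartzBruhatL2Pairing`), so `|⟨MΦ, Φ'⟩| = ‖t‖^{-ι/2} |∫ Ψ(t⁻¹u) conj Ψ'(u) du|` with `Ψ = ΓΦ`, `Ψ' = ΓΦ'`; the integral is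
  `≤ A ∫|Ψ'|` as it stands and `= ‖t‖^ι ∫ Ψ(y) conj Ψ'(t y) dy ≤ ‖t‖^ι A' ∫|Ψ|` after the substitution `u = t y`
  (★ `Weil1964/LocalLinearChangeOfVariables.integral_comp_linearEquiv`).
* `exists_norm_integral_implementer_conjTorus_mul_conj_le` — the same with the constant quantified BEFORE `t`, `a₀`, `M`
  (`∃ C ≥ 0, ∀ t a₀ M, …`), and `exists_norm_integral_implementer_conjTorus_mul_conj_le'` where the isometric `Γ` is produced inside
  (★ `exists_isometric_implementer_gram`).

Written for the Hodge-CM cell `pub/hodgecm-mathlib`, FLOOR 0, crux H413 (stmt-HodgeConjecture-24833), E-2 child line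
`F0_E2SiegelWeilWeilRange`, row C-β (local integrability at a split place of `h ↦ ⟨ω_v(h)Φ, Φ'⟩` for general `Φ, Φ'`; the
`U(J₁)(F_v)`-level transport is the sequel `Li1992/RallisLocalFactorSplitGeneral`).  HC_CM is proved only modulo the printed citations
until rung 0 closes; nothing here is a claim about them.

## References
* [MoeglinVignerasWaldspurger1987] C. Mœglin, M.-F. Vignéras, J.-L. Waldspurger, LNM 1291 (1987), Chap. 2 II.1 (A), II.6, II.10.
* [Weil1964] A. Weil, Acta Math. 111 (1964), Chap. I n° 11–13 (unitarity of the metaplectic operators; the Levi operators).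
* [Li1992] J.-S. Li, J. reine angew. Math. 428 (1992), Thm 2.1 (27) p. 184; §5 p. 206 (the split local integrals).
* [Weil1965] A. Weil, Acta Math. 113 (1965), n° 51 (absolute convergence of the orbital sums in Weil's range).
-/

set_option autoImplicit false

noncomputable section

namespace Literature.RepresentationTheory.HeisenbergGroup

open _root_.MeasureTheory Matrix ValuativeRel
open Literature.NumberTheory.Automorphic Literature.NumberTheory.Automorphic.SchwartzBruhat
open Literature.NumberTheory.GaloisRepresentations.IsNonarchimedeanLocalField
open Literature.NumberTheory.Weil1964
open SymplecticMatrix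
open scoped NNReal ENNReal ComplexConjugate

section ConjugateTorusBound

variable {F : Type*} [Field F] [ValuativeRel F] [TopologicalSpace F] [IsNonarchimedeanLocalField F]
  {ι : Type*} [Fintype ι] [DecidableEq ι] [Invertible (2 : F)] (T : Matrix ι ι F) (hT : IsUnit T.det)
  {ψ : AddChar F Circle} (hl : IsLocallyConstant (⇑ψ : F → Circle))
  (hbT : ∀ y : ι → F, Continuous fun u : ι → F => Matrix.toLinearMap₂' F T u y)
  [MeasurableSpace F] [BorelSpace F] (μ : Measure F) [μ.IsAddHaarMeasure]

omit [ValuativeRel F] [TopologicalSpace F] [IsNonarchimedeanLocalField F] [Invertible (2 : F)] [MeasurableSpace F]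
  [BorelSpace F] in
/-- the inverse of the scalar matrix `t · 1 ∈ GL_ι(F)` is `t⁻¹ · 1`. [cite: Weil1964, Chap. I n° 13, p. 160] -/
theorem coe_inv_of_coe_eq_smul_one' {t : F} (ht0 : t ≠ 0) {a₀ : GL ι F}
    (ha₀ : (a₀ : Matrix ι ι F) = t • (1 : Matrix ι ι F)) :
    ((a₀⁻¹ : GL ι F) : Matrix ι ι F) = t⁻¹ • (1 : Matrix ι ι F) :=
  Units.inv_eq_of_mul_eq_one_right (by rw [ha₀, Matrix.smul_mul, Matrix.one_mul, smul_smul, mul_inv_cancel₀ ht0,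
    one_smul])

omit [Invertible (2 : F)] [MeasurableSpace F] [BorelSpace F] in
/-- the normalising factor of the Levi operator of the scalar `t · 1` is `√(‖t‖^{#ι})`.
[cite: Weil1964, Chap. I n° 13, p. 160] -/
theorem modSqrt_glEquiv_scalar {t : F} {a₀ : GL ι F} (ha₀ : (a₀ : Matrix ι ι F) = t • (1 : Matrix ι ι F)) :
    modSqrt (glEquiv a₀) = Real.sqrt (((normAbs F t : ℝ≥0) : ℝ) ^ Fintype.card ι) := by
  rw [modSqrt_glEquiv, ha₀, Matrix.det_smul, Matrix.det_one, mul_one, map_pow, NNReal.coe_pow]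

omit [Invertible (2 : F)] in
/-- **the substitution `u = t y` against a conjugate**: `∫ Ψ(t⁻¹ u) conj Ψ'(u) dμ^ι(u) = ‖t‖^{#ι} ∫ Ψ(y) conj Ψ'(t y) dμ^ι(y)`.
[cite: WeilBNT1967, Chap. I §2, Th. 3 Cor. 3, pp. 6–7] -/
theorem integral_comp_inv_smul_mul_conj {t : F} (ht0 : t ≠ 0) {a₀ : GL ι F}
    (ha₀ : (a₀ : Matrix ι ι F) = t • (1 : Matrix ι ι F)) (Ψ Ψ' : (ι → F) → ℂ) :
    ∫ u, Ψ (t⁻¹ • u) * conj (Ψ' u) ∂(Measure.pi fun _ : ι => μ) =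
      ((((normAbs F t : ℝ≥0) : ℝ) ^ Fintype.card ι : ℝ) : ℂ) *
        ∫ y, Ψ y * conj (Ψ' (t • y)) ∂(Measure.pi fun _ : ι => μ) := by
  have hdet : ((normAbs F (LinearMap.det ((glEquiv a₀ : (ι → F) ≃ₗ[F] (ι → F)) : (ι → F) →ₗ[F] (ι → F))) : ℝ≥0) : ℝ) =
      ((normAbs F t : ℝ≥0) : ℝ) ^ Fintype.card ι := by
    rw [← modSqrt_sq, modSqrt_glEquiv_scalar ha₀, Real.sq_sqrt (pow_nonneg (NNReal.coe_nonneg _) _)]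
  have hpos : (0 : ℝ) < ((normAbs F t : ℝ≥0) : ℝ) ^ Fintype.card ι := by
    have h0 : (0 : ℝ) < ((normAbs F t : ℝ≥0) : ℝ) := by
      have : normAbs F t ≠ 0 := (map_ne_zero (normAbs F)).2 ht0
      exact_mod_cast pos_iff_ne_zero.2 this
    exact pow_pos h0 _
  -- `∫ φ(e y) = ‖det e‖⁻¹ ∫ φ` with `e = (y ↦ t y)` and `φ(u) = Ψ(t⁻¹u) conj Ψ'(u)`
  have h := integral_comp_linearEquiv μ (glEquiv a₀) (fun u => Ψ (t⁻¹ • u) * conj (Ψ' u))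
  have he : ∀ y : ι → F, (glEquiv a₀) y = t • y := fun y => by
    rw [glEquiv_apply, ha₀, Matrix.smul_mulVec, Matrix.one_mulVec]
  simp only [he, smul_smul, inv_mul_cancel₀ ht0, one_smul] at h
  have hdet' : ((normAbs F (LinearMap.det ((glEquiv a₀ : (ι → F) ≃ₗ[F] (ι → F)) : (ι → F) →ₗ[F] (ι → F)))⁻¹ :
      ℝ≥0) : ℝ) = (((normAbs F t : ℝ≥0) : ℝ) ^ Fintype.card ι)⁻¹ := by
    rw [map_inv₀, NNReal.coe_inv, hdet]
  rw [h, hdet', Complex.real_smul, Complex.ofReal_inv, ← mul_assoc,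
    mul_inv_cancel₀ (Complex.ofReal_ne_zero.2 hpos.ne'), one_mul]

include hT in
/-- **THE DECAY OF THE MATRIX COEFFICIENTS OF A DARBOUX-CONJUGATE SCALAR TORUS.**  Let `γ ∈ Sp(W, A_T)` have an `L²(μ^ι)`-isometric
implementer `Γ`, let `t ≠ 0`, `a₀ = t · 1`, and let `M` be an `L²(μ^ι)`-isometric implementer of `γ⁻¹ m(a₀) γ`.  For Schwartz–Bruhat
`Φ, Φ'` with `|ΓΦ| ≤ A`, `|ΓΦ'| ≤ A'` pointwise:
`‖∫ (MΦ) conj Φ' dμ^ι‖ ≤ max(A · ∫|ΓΦ'| dμ^ι, (∫|ΓΦ| dμ^ι) · A') · min(r, r⁻¹)`, `r = √(‖t‖^{#ι})`.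
[cite: MoeglinVignerasWaldspurger1987, Chap. 2 II.1 (A), II.6] [cite: Weil1964, Chap. I n° 13] [cite: Li1992, §5 p. 206] -/
theorem norm_integral_implementer_conjTorus_mul_conj_le (hψ : ψ.IsContinuousNontrivial)
    (γ : symplecticGroup (polar (Matrix.toLinearMap₂' F T)))
    {Γ : SchwartzBruhat (ι → F) ≃ₗ[ℂ] SchwartzBruhat (ι → F)}
    (hΓ : Implements (schrodingerSB (Matrix.toLinearMap₂' F T) ψ hl hbT) (ofSymplectic _ γ) Γ)
    (hΓiso : ∀ Φ, l2NormSq (Measure.pi fun _ : ι => μ) (Γ Φ) = l2NormSq (Measure.pi fun _ : ι => μ) Φ)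
    {t : F} (ht0 : t ≠ 0) {a₀ : GL ι F} (ha₀ : (a₀ : Matrix ι ι F) = t • (1 : Matrix ι ι F))
    {M : SchwartzBruhat (ι → F) ≃ₗ[ℂ] SchwartzBruhat (ι → F)}
    (hM : Implements (schrodingerSB (Matrix.toLinearMap₂' F T) ψ hl hbT)
      (ofSymplectic _ (γ⁻¹ * transportSp T hT (levi a₀) * γ)) M)
    (hMiso : ∀ Φ, l2NormSq (Measure.pi fun _ : ι => μ) (M Φ) = l2NormSq (Measure.pi fun _ : ι => μ) Φ)
    (Φ Φ' : SchwartzBruhat (ι → F)) {A A' : ℝ}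
    (hA : ∀ u, ‖((Γ Φ : SchwartzBruhat (ι → F)) : (ι → F) → ℂ) u‖ ≤ A)
    (hA' : ∀ u, ‖((Γ Φ' : SchwartzBruhat (ι → F)) : (ι → F) → ℂ) u‖ ≤ A') :
    ‖∫ x, ((M Φ : SchwartzBruhat (ι → F)) : (ι → F) → ℂ) x * conj (((Φ' : SchwartzBruhat (ι → F)) : (ι → F) → ℂ) x)
        ∂(Measure.pi fun _ : ι => μ)‖ ≤
      max (A * ∫ u, ‖((Γ Φ' : SchwartzBruhat (ι → F)) : (ι → F) → ℂ) u‖ ∂(Measure.pi fun _ : ι => μ))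
          ((∫ u, ‖((Γ Φ : SchwartzBruhat (ι → F)) : (ι → F) → ℂ) u‖ ∂(Measure.pi fun _ : ι => μ)) * A') *
        min (Real.sqrt (((normAbs F t : ℝ≥0) : ℝ) ^ Fintype.card ι))
          (Real.sqrt (((normAbs F t : ℝ≥0) : ℝ) ^ Fintype.card ι))⁻¹ := by
  classical
  haveI : SecondCountableTopology F := secondCountableTopology_localField F
  set Ψ : SchwartzBruhat (ι → F) := Γ Φ with hΨ
  set Ψ' : SchwartzBruhat (ι → F) := Γ Φ' with hΨ'
  set r : ℝ := Real.sqrt (((normAbs F t : ℝ≥0) : ℝ) ^ Fintype.card ι) with hr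
  have hnt : (0 : ℝ) < ((normAbs F t : ℝ≥0) : ℝ) := by
    have : normAbs F t ≠ 0 := (map_ne_zero (normAbs F)).2 ht0
    exact_mod_cast pos_iff_ne_zero.2 this
  have hrpow : (0 : ℝ) < ((normAbs F t : ℝ≥0) : ℝ) ^ Fintype.card ι := pow_pos hnt _
  have hr0 : 0 < r := Real.sqrt_pos.2 hrpow
  have hrsq : r ^ 2 = ((normAbs F t : ℝ≥0) : ℝ) ^ Fintype.card ι := Real.sq_sqrt hrpow.le
  -- nonnegativity of the data
  have hA0 : 0 ≤ A := le_trans (norm_nonneg _) (hA 0)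
  have hA'0 : 0 ≤ A' := le_trans (norm_nonneg _) (hA' 0)
  -- (1) the normalised Levi operator and the conjugate implementer `N = Γ⁻¹ ∘ r(m(a₀)) ∘ Γ`
  have hL : Implements (schrodingerSB (Matrix.toLinearMap₂' F T) ψ hl hbT) (ofSymplectic _ (transportSp T hT (levi a₀)))
      (leviOpPi (glEquiv a₀)) := implements_transportSp_levi_leviOpPi T hT hl hbT a₀
  have hN : Implements (schrodingerSB (Matrix.toLinearMap₂' F T) ψ hl hbT)
      (ofSymplectic _ (γ⁻¹ * transportSp T hT (levi a₀) * γ)) (Γ⁻¹ * leviOpPi (glEquiv a₀) * Γ) := by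
    rw [map_mul, map_mul, map_inv]
    exact Implements.mul _ (Implements.mul _ (Implements.inv _ hΓ) hL) hΓ
  obtain ⟨c, hc⟩ := implementerUniqueUpToScalar_schrodingerSB_gram T hT hl hbT hψ _ _ _ hN hM
  -- (2) `|c| = 1`: both implementers are isometric and `𝒮 ≠ 0`
  have hΓsymm_iso : ∀ Θ, l2NormSq (Measure.pi fun _ : ι => μ) (Γ.symm Θ) = l2NormSq (Measure.pi fun _ : ι => μ) Θ := fun Θ => by
    rw [← hΓiso (Γ.symm Θ), Γ.apply_symm_apply]
  have hNiso : ∀ Θ, l2NormSq (Measure.pi fun _ : ι => μ) ((Γ⁻¹ * leviOpPi (glEquiv a₀) * Γ) Θ) = l2NormSq (Measure.pi fun _ : ι => μ) Θ := fun Θ => by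
    rw [LinearEquiv.mul_apply, LinearEquiv.mul_apply, LinearEquiv.coe_inv, hΓsymm_iso, l2NormSq_leviOpPi, hΓiso]
  have hc1 : ‖(c : ℂ)‖ = 1 := by
    have hne : (piBallSB F ι 0 : SchwartzBruhat (ι → F)) ≠ 0 := piBallSB_zero_ne_zero
    have hn0 : l2NormSq (Measure.pi fun _ : ι => μ) (piBallSB F ι 0) ≠ 0 := (l2NormSq_pos (Measure.pi fun _ : ι => μ) hne).ne'
    have hntop : l2NormSq (Measure.pi fun _ : ι => μ) (piBallSB F ι 0) ≠ ∞ := l2NormSq_ne_top (Measure.pi fun _ : ι => μ) _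
    have h1 : ‖(c : ℂ)‖ₑ ^ 2 * l2NormSq (Measure.pi fun _ : ι => μ) (piBallSB F ι 0) = 1 * l2NormSq (Measure.pi fun _ : ι => μ) (piBallSB F ι 0) := by
      have h0 := hMiso (piBallSB F ι 0)
      rw [hc, l2NormSq_smul, hNiso] at h0
      rw [h0, one_mul]
    have h2 : ‖(c : ℂ)‖ₑ ^ 2 = 1 := (ENNReal.mul_left_inj hn0 hntop).1 h1
    have h3 := congrArg ENNReal.toReal h2
    rw [ENNReal.toReal_pow, ← ofReal_norm, ENNReal.toReal_ofReal (norm_nonneg _), ENNReal.toReal_one] at h3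
    exact (pow_eq_one_iff_of_nonneg (norm_nonneg _) two_ne_zero).1 h3
  -- (3) the coefficient through `Γ`: `⟨MΦ, Φ'⟩ = c · ⟨r(m(a₀)) Ψ, Ψ'⟩`
  have hpair : ∫ x, ((M Φ : SchwartzBruhat (ι → F)) : (ι → F) → ℂ) x * conj (((Φ' : SchwartzBruhat (ι → F)) : (ι → F) → ℂ) x) ∂(Measure.pi fun _ : ι => μ) =
      (c : ℂ) * ∫ x, ((leviOpPi (glEquiv a₀) Ψ : SchwartzBruhat (ι → F)) : (ι → F) → ℂ) x *
        conj (((Ψ' : SchwartzBruhat (ι → F)) : (ι → F) → ℂ) x) ∂(Measure.pi fun _ : ι => μ) := by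
    have key := integral_mul_conj_equiv_eq_of_l2NormSq_eq (Measure.pi fun _ : ι => μ) Γ hΓiso (Γ.symm (leviOpPi (glEquiv a₀) Ψ)) Φ'
    rw [Γ.apply_symm_apply] at key
    have hMΦ : M Φ = (c : ℂ) • Γ.symm (leviOpPi (glEquiv a₀) Ψ) := by
      rw [hc Φ, LinearEquiv.mul_apply, LinearEquiv.mul_apply, LinearEquiv.coe_inv]
    rw [hMΦ, key, ← integral_const_mul]
    refine integral_congr_ae (Filter.Eventually.of_forall fun x => ?_)
    simp only [Submodule.coe_smul, Pi.smul_apply, smul_eq_mul, mul_assoc]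
  -- (4) the Levi coefficient: `⟨r(m(a₀))Ψ, Ψ'⟩ = r⁻¹ ∫ Ψ(t⁻¹u) conj Ψ'(u)`
  have hmod : modSqrt (glEquiv a₀) = r := by rw [hr, modSqrt_glEquiv_scalar ha₀]
  have hlevi : ∫ x, ((leviOpPi (glEquiv a₀) Ψ : SchwartzBruhat (ι → F)) : (ι → F) → ℂ) x *
        conj (((Ψ' : SchwartzBruhat (ι → F)) : (ι → F) → ℂ) x) ∂(Measure.pi fun _ : ι => μ) =
      ((r : ℂ))⁻¹ * ∫ u, ((Ψ : SchwartzBruhat (ι → F)) : (ι → F) → ℂ) (t⁻¹ • u) *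
        conj (((Ψ' : SchwartzBruhat (ι → F)) : (ι → F) → ℂ) u) ∂(Measure.pi fun _ : ι => μ) := by
    rw [← integral_const_mul]
    refine integral_congr_ae (Filter.Eventually.of_forall fun u => ?_)
    simp only [coe_leviOpPi_apply, glEquiv_symm_apply, coe_inv_of_coe_eq_smul_one' ht0 ha₀, Matrix.smul_mulVec,
      Matrix.one_mulVec, hmod, mul_assoc]
  -- (5) the two bounds on `I = ∫ Ψ(t⁻¹u) conj Ψ'(u)`
  have hΨint : Integrable (fun u => ‖((Ψ : SchwartzBruhat (ι → F)) : (ι → F) → ℂ) u‖) (Measure.pi fun _ : ι => μ) :=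
    (Ψ.2.1.continuous.integrable_of_hasCompactSupport Ψ.2.2).norm
  have hΨ'int : Integrable (fun u => ‖((Ψ' : SchwartzBruhat (ι → F)) : (ι → F) → ℂ) u‖) (Measure.pi fun _ : ι => μ) :=
    (Ψ'.2.1.continuous.integrable_of_hasCompactSupport Ψ'.2.2).norm
  have hI1 : ‖∫ u, ((Ψ : SchwartzBruhat (ι → F)) : (ι → F) → ℂ) (t⁻¹ • u) *
        conj (((Ψ' : SchwartzBruhat (ι → F)) : (ι → F) → ℂ) u) ∂(Measure.pi fun _ : ι => μ)‖ ≤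
      A * ∫ u, ‖((Ψ' : SchwartzBruhat (ι → F)) : (ι → F) → ℂ) u‖ ∂(Measure.pi fun _ : ι => μ) := by
    rw [← integral_const_mul]
    refine norm_integral_le_of_norm_le (hΨ'int.const_mul A) (Filter.Eventually.of_forall fun u => ?_)
    rw [norm_mul, Complex.norm_conj]
    exact mul_le_mul_of_nonneg_right (hA _) (norm_nonneg _)
  have hI2 : ‖∫ u, ((Ψ : SchwartzBruhat (ι → F)) : (ι → F) → ℂ) (t⁻¹ • u) *
        conj (((Ψ' : SchwartzBruhat (ι → F)) : (ι → F) → ℂ) u) ∂(Measure.pi fun _ : ι => μ)‖ ≤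
      r ^ 2 * ((∫ u, ‖((Ψ : SchwartzBruhat (ι → F)) : (ι → F) → ℂ) u‖ ∂(Measure.pi fun _ : ι => μ)) * A') := by
    rw [integral_comp_inv_smul_mul_conj μ ht0 ha₀, norm_mul, ← hrsq, Complex.norm_real, Real.norm_of_nonneg (pow_nonneg hr0.le 2)]
    refine mul_le_mul_of_nonneg_left ?_ (pow_nonneg hr0.le 2)
    rw [← integral_mul_const]
    refine norm_integral_le_of_norm_le (hΨint.mul_const A') (Filter.Eventually.of_forall fun u => ?_)
    rw [norm_mul, Complex.norm_conj]
    exact mul_le_mul_of_nonneg_left (hA' _) (norm_nonneg _)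
  -- (6) assemble
  rw [hpair, hlevi, norm_mul, hc1, one_mul, norm_mul, norm_inv, Complex.norm_real, Real.norm_of_nonneg hr0.le]
  set I := ‖∫ u, ((Ψ : SchwartzBruhat (ι → F)) : (ι → F) → ℂ) (t⁻¹ • u) *
        conj (((Ψ' : SchwartzBruhat (ι → F)) : (ι → F) → ℂ) u) ∂(Measure.pi fun _ : ι => μ)‖ with hI
  set X := A * ∫ u, ‖((Ψ' : SchwartzBruhat (ι → F)) : (ι → F) → ℂ) u‖ ∂(Measure.pi fun _ : ι => μ) with hX
  set Y := (∫ u, ‖((Ψ : SchwartzBruhat (ι → F)) : (ι → F) → ℂ) u‖ ∂(Measure.pi fun _ : ι => μ)) * A' with hY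
  have hI0 : 0 ≤ I := norm_nonneg _
  have hX0 : 0 ≤ X := mul_nonneg hA0 (integral_nonneg fun _ => norm_nonneg _)
  have hY0 : 0 ≤ Y := mul_nonneg (integral_nonneg fun _ => norm_nonneg _) hA'0
  -- `r⁻¹ I ≤ X r⁻¹` and `r⁻¹ I ≤ Y r`
  have hb1 : r⁻¹ * I ≤ max X Y * r⁻¹ := by
    rw [mul_comm]
    exact mul_le_mul_of_nonneg_right (hI1.trans (le_max_left _ _)) (inv_nonneg.2 hr0.le)
  have hb2 : r⁻¹ * I ≤ max X Y * r := by
    have h2 : r⁻¹ * I ≤ r⁻¹ * (r ^ 2 * Y) := mul_le_mul_of_nonneg_left hI2 (inv_nonneg.2 hr0.le)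
    have h3 : r⁻¹ * (r ^ 2 * Y) = Y * r := by
      calc r⁻¹ * (r ^ 2 * Y) = r⁻¹ * r * r * Y := by ring
        _ = Y * r := by rw [inv_mul_cancel₀ hr0.ne', one_mul, mul_comm]
    rw [h3] at h2
    exact h2.trans (mul_le_mul_of_nonneg_right (le_max_right _ _) hr0.le)
  rcases le_total r r⁻¹ with hle | hle
  · rw [min_eq_left hle]; exact hb2
  · rw [min_eq_right hle]; exact hb1

include hT in
/-- **the decay bound with the constant quantified before the torus element**: for `γ`, an isometric implementer `Γ` of `γ` and
Schwartz–Bruhat `Φ, Φ'` there is `C ≥ 0` such that for EVERY `t ≠ 0`, `a₀ = t·1` and every isometric implementer `M` of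
`γ⁻¹ m(a₀) γ`: `‖∫ (MΦ) conj Φ' dμ^ι‖ ≤ C · min(√(‖t‖^{#ι}), (√(‖t‖^{#ι}))⁻¹)`.
[cite: MoeglinVignerasWaldspurger1987, Chap. 2 II.1 (A), II.6] [cite: Li1992, §5 p. 206] -/
theorem exists_norm_integral_implementer_conjTorus_mul_conj_le (hψ : ψ.IsContinuousNontrivial)
    (γ : symplecticGroup (polar (Matrix.toLinearMap₂' F T)))
    {Γ : SchwartzBruhat (ι → F) ≃ₗ[ℂ] SchwartzBruhat (ι → F)}
    (hΓ : Implements (schrodingerSB (Matrix.toLinearMap₂' F T) ψ hl hbT) (ofSymplectic _ γ) Γ)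
    (hΓiso : ∀ Φ, l2NormSq (Measure.pi fun _ : ι => μ) (Γ Φ) = l2NormSq (Measure.pi fun _ : ι => μ) Φ)
    (Φ Φ' : SchwartzBruhat (ι → F)) :
    ∃ C : ℝ, 0 ≤ C ∧ ∀ {t : F}, t ≠ 0 → ∀ {a₀ : GL ι F}, (a₀ : Matrix ι ι F) = t • (1 : Matrix ι ι F) →
      ∀ {M : SchwartzBruhat (ι → F) ≃ₗ[ℂ] SchwartzBruhat (ι → F)},
        Implements (schrodingerSB (Matrix.toLinearMap₂' F T) ψ hl hbT)
          (ofSymplectic _ (γ⁻¹ * transportSp T hT (levi a₀) * γ)) M →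
        (∀ Φ, l2NormSq (Measure.pi fun _ : ι => μ) (M Φ) = l2NormSq (Measure.pi fun _ : ι => μ) Φ) →
        ‖∫ x, ((M Φ : SchwartzBruhat (ι → F)) : (ι → F) → ℂ) x * conj (((Φ' : SchwartzBruhat (ι → F)) : (ι → F) → ℂ) x)
            ∂(Measure.pi fun _ : ι => μ)‖ ≤
          C * min (Real.sqrt (((normAbs F t : ℝ≥0) : ℝ) ^ Fintype.card ι))
            (Real.sqrt (((normAbs F t : ℝ≥0) : ℝ) ^ Fintype.card ι))⁻¹ := by
  obtain ⟨A, hA0, hA⟩ := exists_norm_le_of_mem_schwartzBruhat (Γ Φ).2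
  obtain ⟨A', hA'0, hA'⟩ := exists_norm_le_of_mem_schwartzBruhat (Γ Φ').2
  refine ⟨max (A * ∫ u, ‖((Γ Φ' : SchwartzBruhat (ι → F)) : (ι → F) → ℂ) u‖ ∂(Measure.pi fun _ : ι => μ))
      ((∫ u, ‖((Γ Φ : SchwartzBruhat (ι → F)) : (ι → F) → ℂ) u‖ ∂(Measure.pi fun _ : ι => μ)) * A'),
    le_max_of_le_left (mul_nonneg hA0 (integral_nonneg fun _ => norm_nonneg _)),
    fun ht0 _ ha₀ _ hM hMiso => ?_⟩
  exact norm_integral_implementer_conjTorus_mul_conj_le T hT hl hbT μ hψ γ hΓ hΓiso ht0 ha₀ hM hMiso Φ Φ' hA hA'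

include hT in
/-- **the decay bound, isometric `Γ` supplied by the tree** (★ `exists_isometric_implementer_gram`): for every `γ ∈ Sp(W, A_T)` and
Schwartz–Bruhat `Φ, Φ'` there is `C ≥ 0` with `‖∫ (MΦ) conj Φ' dμ^ι‖ ≤ C · min(√(‖t‖^{#ι}), (√(‖t‖^{#ι}))⁻¹)` for every `t ≠ 0`,
`a₀ = t·1` and every isometric implementer `M` of `γ⁻¹ m(a₀) γ`.
[cite: MoeglinVignerasWaldspurger1987, Chap. 2 II.1 (A), II.6] [cite: Weil1964, Chap. I n° 13] [cite: Li1992, §5 p. 206] -/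
theorem exists_norm_integral_implementer_conjTorus_mul_conj_le' (hψ : ψ.IsContinuousNontrivial)
    (γ : symplecticGroup (polar (Matrix.toLinearMap₂' F T))) (Φ Φ' : SchwartzBruhat (ι → F)) :
    ∃ C : ℝ, 0 ≤ C ∧ ∀ {t : F}, t ≠ 0 → ∀ {a₀ : GL ι F}, (a₀ : Matrix ι ι F) = t • (1 : Matrix ι ι F) →
      ∀ {M : SchwartzBruhat (ι → F) ≃ₗ[ℂ] SchwartzBruhat (ι → F)},
        Implements (schrodingerSB (Matrix.toLinearMap₂' F T) ψ hl hbT)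
          (ofSymplectic _ (γ⁻¹ * transportSp T hT (levi a₀) * γ)) M →
        (∀ Φ, l2NormSq (Measure.pi fun _ : ι => μ) (M Φ) = l2NormSq (Measure.pi fun _ : ι => μ) Φ) →
        ‖∫ x, ((M Φ : SchwartzBruhat (ι → F)) : (ι → F) → ℂ) x * conj (((Φ' : SchwartzBruhat (ι → F)) : (ι → F) → ℂ) x)
            ∂(Measure.pi fun _ : ι => μ)‖ ≤
          C * min (Real.sqrt (((normAbs F t : ℝ≥0) : ℝ) ^ Fintype.card ι))
            (Real.sqrt (((normAbs F t : ℝ≥0) : ℝ) ^ Fintype.card ι))⁻¹ := by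
  haveI : SecondCountableTopology F := secondCountableTopology_localField F
  obtain ⟨m, hm⟩ := hψ.exists_hasConductorExp
  obtain ⟨Γ, hΓ, hΓiso⟩ := exists_isometric_implementer_gram T hT hl hbT μ hψ hm γ
  exact exists_norm_integral_implementer_conjTorus_mul_conj_le T hT hl hbT μ hψ γ hΓ hΓiso Φ Φ'

end ConjugateTorusBound

end Literature.RepresentationTheory.HeisenbergGroup

end
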